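import Mathlib
import HarnessLib
import Literature.MathematicalPhysics.KineticTheory.HardSphereEuler
import Literature.MathematicalPhysics.KineticTheory.BackwardCluster
import Summits.AtomisticToContinuum.HydrodynamicLimit.Theorems.RelayRaceLocalityGibbsLightConeStubChainOfMember

/-!
# Stub `stub_simpleChainOfMember` of the line `Sketch` (log-window-tagged-tail) for the crux
`RelayRaceLocality.GibbsLightCone` (stmt-AtomisticToContinuum-12501)

Registered stub of the lead prover's reshaped skeleton (`Cruxes/GibbsLightCone/Lines/Sketch.lean`,
revision 6): SIMPLE CHAIN OF A MEMBER — the LOOP ERASURE of the landed `stub_chainOfMember`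
(`RelayRaceLocalityGibbsLightConeStubChainOfMember.lean`): on the good set of a hard-sphere flow on
`𝕋³`, every member `j` of the backward cluster of `i` over `(s, t]` is joined to `i` by a strictly
time-ordered collision chain inside the window THROUGH PAIRWISE DISTINCT PARTICLES
(`Function.Injective q`).

Proof (purely combinatorial, for an abstract link predicate `L : α → α → ℝ → Prop` and an
arbitrary set `S` of admissible times): induction over the number of links. A chain
`x = q 0 → q 1 → ⋯ → q (k+1) = i` is the link `(q 0, q 1)` at time `τ 0` prepended to the tail
chain from `q 1` to `i`, whose times exceed `τ 0`; loop-erase the tail by induction (keeping its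
times inside `S ∩ (τ 0, ∞)`); if `x` does not occur on the erased tail, prepend the first link
(`Fin.cons_injective_iff`); if it occurs at position `c`, the suffix of the erased tail from `c`
is already a simple chain from `x` to `i` (`simpleChain_suffix`). The stub follows by
specialising to the links `s(a, b) ∈ contactPairSet 𝕋³ ε (Φ_u z)` and `S = (s, t]` and feeding in
the chain of `stub_chainOfMember`.
-/

namespace Summit.AtomisticToContinuum.HydrodynamicLimit.Theorems.LogWindowTaggedTail

open Literature.MathematicalPhysics.KineticTheory Literature.Analysis.FluidPDE MeasureTheory Filter Set

/-- SUFFIX OF A SIMPLE CHAIN (abstract link predicate `L`, admissible times `S`): the part of a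
simple, strictly time-ordered chain `q 0 → ⋯ → q k = i` from any position `c` on is a simple,
strictly time-ordered chain from `q c` to `i` with links and times among the original ones.
[folklore] -/
theorem simpleChain_suffix {α : Type*} (L : α → α → ℝ → Prop) (S : Set ℝ) (i : α) :
    ∀ (k : ℕ) (q : Fin (k + 1) → α) (τ : Fin k → ℝ) (c : Fin (k + 1)),
      q (Fin.last k) = i → Function.Injective q → StrictMono τ → (∀ m, τ m ∈ S) →
      (∀ m : Fin k, L (q (Fin.castSucc m)) (q (Fin.succ m)) (τ m)) →
      ∃ (k' : ℕ) (q' : Fin (k' + 1) → α) (τ' : Fin k' → ℝ),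
        q' 0 = q c ∧ q' (Fin.last k') = i ∧ Function.Injective q' ∧ StrictMono τ' ∧
        (∀ m, τ' m ∈ S) ∧ ∀ m : Fin k', L (q' (Fin.castSucc m)) (q' (Fin.succ m)) (τ' m)
  | 0, q, τ, c, hqk, hinj, hmono, hS, hlink =>
    ⟨0, q, τ, congrArg q (Fin.subsingleton_one.elim _ _), hqk, hinj, hmono, hS, hlink⟩
  | k + 1, q, τ, c, hqk, hinj, hmono, hS, hlink => by
    refine Fin.cases ?_ (fun c' => ?_) c
    · exact ⟨k + 1, q, τ, rfl, hqk, hinj, hmono, hS, hlink⟩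
    · -- the suffix from `c'.succ` is the suffix from `c'` of the tail chain
      exact simpleChain_suffix L S i k (Fin.tail q) (Fin.tail τ) c'
        (by rw [← hqk, ← Fin.succ_last]; rfl) (hinj.comp (Fin.succ_injective _))
        (fun a b h => hmono (Fin.succ_lt_succ_iff.2 h)) (fun m => hS _)
        (fun m => by simpa only [Fin.tail, Fin.succ_castSucc] using hlink m.succ)

/-- LOOP ERASURE (abstract link predicate `L`, admissible times `S`): every strictly time-ordered
chain `q 0 → q 1 → ⋯ → q k = i` with times in `S` contains a SIMPLE (pairwise distinct particles)
strictly time-ordered chain from `q 0` to `i` whose links, with their times, are among the original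
ones — erase the loop between two visits of the same particle, keeping the later outgoing link.
[folklore] -/
theorem simpleChain_of_chain {α : Type*} (L : α → α → ℝ → Prop) (i : α) :
    ∀ (k : ℕ) (S : Set ℝ) (q : Fin (k + 1) → α) (τ : Fin k → ℝ),
      q (Fin.last k) = i → StrictMono τ → (∀ m, τ m ∈ S) →
      (∀ m : Fin k, L (q (Fin.castSucc m)) (q (Fin.succ m)) (τ m)) →
      ∃ (k' : ℕ) (q' : Fin (k' + 1) → α) (τ' : Fin k' → ℝ),
        q' 0 = q 0 ∧ q' (Fin.last k') = i ∧ Function.Injective q' ∧ StrictMono τ' ∧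
        (∀ m, τ' m ∈ S) ∧ ∀ m : Fin k', L (q' (Fin.castSucc m)) (q' (Fin.succ m)) (τ' m)
  | 0, S, q, τ, hqk, hmono, hS, hlink =>
    ⟨0, q, τ, rfl, hqk, fun a b _ => Fin.subsingleton_one.elim a b, hmono, hS, hlink⟩
  | k + 1, S, q, τ, hqk, hmono, hS, hlink => by
    classical
    -- loop-erase the tail chain from `q 1` to `i`, whose times all exceed `τ 0`
    obtain ⟨k', q', τ', hq0, hqk', hinj, hmono', hS', hlink'⟩ :=
      simpleChain_of_chain L i k (S ∩ Set.Ioi (τ 0)) (Fin.tail q) (Fin.tail τ)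
        (by rw [← hqk, ← Fin.succ_last]; rfl) (fun a b h => hmono (Fin.succ_lt_succ_iff.2 h))
        (fun m => ⟨hS _, hmono (Fin.succ_pos m)⟩)
        (fun m => by simpa only [Fin.tail, Fin.succ_castSucc] using hlink m.succ)
    by_cases hx : q 0 ∈ Set.range q'
    · -- `q 0` reappears on the erased tail at position `c`: keep only the suffix from `c`
      obtain ⟨c, hc⟩ := hx
      obtain ⟨k'', q'', τ'', h0, hlast, hinj', hmono'', hS'', hlink''⟩ :=
        simpleChain_suffix L (S ∩ Set.Ioi (τ 0)) i k' q' τ' c hqk' hinj hmono' hS' hlink'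
      exact ⟨k'', q'', τ'', h0.trans hc, hlast, hinj', hmono'', fun m => (hS'' m).1, hlink''⟩
    · -- `q 0` is fresh: prepend the first link `(q 0, q 1)` at time `τ 0`
      refine ⟨k' + 1, Fin.cons (q 0) q', Fin.cons (τ 0) τ', rfl, ?_,
        Fin.cons_injective_iff.2 ⟨hx, hinj⟩,
        chainOfMember_strictMono_cons hmono' fun m => (hS' m).2, fun m => ?_, fun m => ?_⟩
      · rw [← Fin.succ_last, Fin.cons_succ]
        exact hqk'
      · refine Fin.cases ?_ (fun m' => ?_) m
        · simpa using hS 0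
        · rw [Fin.cons_succ]
          exact (hS' m').1
      · refine Fin.cases ?_ (fun m' => ?_) m
        · simpa [hq0, Fin.tail] using hlink 0
        · rw [Fin.cons_succ, ← Fin.succ_castSucc, Fin.cons_succ, Fin.cons_succ]
          exact hlink' m'

/-- SIMPLE CHAIN OF A MEMBER (registered stub `stub_simpleChainOfMember` of the line `Sketch` for
the crux `GibbsLightCone`, stmt-AtomisticToContinuum-12501; deterministic loop erasure of
`stub_chainOfMember`): on the good set, every member `j` of the backward cluster of `i` over
`(s, t]` is joined to `i` by a strictly time-ordered collision chain inside the window through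
PAIRWISE DISTINCT particles `q 0 = j, q 1, …, q k = i` (`Function.Injective q`), the pair
`{q m, q (m+1)}` being in contact at time `τ m`, `s < τ 0 < ⋯ < τ (k-1) ≤ t` (APST 2015 §1/§5:
the cluster is built from time-ordered collision sequences; a repeated particle is short-cut by its
later outgoing collision). [folklore] -/
theorem stub_simpleChainOfMember :
    ∀ (N : ℕ) (ε : ℝ) (Φ : HardSphereFlow (Torus.geometry (Fin 3)) ε N) (z : Config N (Fin 3) T3),
      z ∈ Φ.good → ∀ (i j : Fin N) (s t : ℝ), j ∈ Φ.backwardCluster i s t z →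
        ∃ (k : ℕ) (q : Fin (k + 1) → Fin N) (τ : Fin k → ℝ),
          q 0 = j ∧ q (Fin.last k) = i ∧ Function.Injective q ∧ StrictMono τ ∧
          (∀ m, τ m ∈ Set.Ioc s t) ∧
          ∀ m : Fin k, s(q (Fin.castSucc m), q (Fin.succ m)) ∈
            contactPairSet (Torus.geometry (Fin 3)) ε (Φ.flow (τ m) z) := by
  intro N ε Φ z hz i j s t hj
  obtain ⟨k, q, τ, hq0, hqk, hmono, hwin, hlink⟩ := stub_chainOfMember N ε Φ z hz i j s t hj
  obtain ⟨k', q', τ', hq0', hqk', hinj, hmono', hwin', hlink'⟩ :=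
    simpleChain_of_chain
      (fun a b u => s(a, b) ∈ contactPairSet (Torus.geometry (Fin 3)) ε (Φ.flow u z)) i k
      (Set.Ioc s t) q τ hqk hmono hwin hlink
  exact ⟨k', q', τ', hq0'.trans hq0, hqk', hinj, hmono', hwin', hlink'⟩

end Summit.AtomisticToContinuum.HydrodynamicLimit.Theorems.LogWindowTaggedTail
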